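import Literature.NumberTheory.EllipticCurves.PadicSeriesEvaluationMv
import Literature.NumberTheory.EllipticCurves.PadicSeriesIdentityProofs
import Mathlib.Algebra.MvPolynomial.Funext
import Mathlib.Algebra.Order.Antidiag.Finsupp
import Mathlib.RingTheory.MvPowerSeries.Trunc
import HarnessLib

/-!
# The identity theorem for integral power series in finitely many variables (proofs only)

Trunk T-NT-EC (Literature/NumberTheory/EllipticCurves). An integral `F ∈ ℤ_p⟦σ⟧ ⊂ ℚ_p⟦σ⟧`
(`σ` finite) whose values `padicEvalMv F pt` vanish on the open unit polydisc is ZERO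
(`eq_zero_of_padicEvalMv_eq_zero`), hence two integral series with the same values are equal
(`eq_of_padicEvalMv_eq`). Proof by RESTRICTION TO LINES: for `a ∈ ℤ_p^σ` the one-variable
series `F(a·T) = subst (s ↦ aₛ·T) F` has values `F(a·t)` (evaluation commutes with substitution,
`PadicSeriesEvaluationMv.lean`), so it vanishes by the one-variable identity theorem
(`PadicSeriesIdentityProofs.lean`); its `n`-th coefficient is the degree-`n` homogeneous part of `F` (the polynomial
`MvPowerSeries.truncFinset ℚ_[p] (univ.finsuppAntidiag n) F` of Mathlib) evaluated at `a`
(`coeff_subst_line`, `eval_truncFinset_antidiag`), a POLYNOMIAL identity, and a polynomial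
vanishing on a box with infinite sides is zero (Mathlib's `MvPolynomial.funext_set`). This is the
density principle turning identities of a formal group law at points (e.g. associativity of
`WeierstrassCurve.formalGroupLaw`, `FormalGroupLawPadicProofs.lean`) into identities of power
series.

## References

* Folklore (several-variable Strassmann / `p`-adic Weierstrass preparation give more).
-/

noncomputable section

open PowerSeries

namespace Literature.NumberTheory.EllipticCurves

variable {p : ℕ} [Fact p.Prime] {σ : Type*} [Fintype σ] [DecidableEq σ]

/-- `padicEval` is `padicEvalMv` on `Unit`. [folklore] -/
theorem padicEval_eq_padicEvalMv (f : ℚ_[p]⟦X⟧) (t : ℚ_[p]) :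
    padicEval f t = padicEvalMv f (fun _ : Unit => t) := by
  unfold padicEval padicEvalMv
  rw [← (Finsupp.single_injective ()).tsum_eq fun d _ => ⟨d (), by ext; simp⟩]
  congr 1; funext n
  rw [Finsupp.prod_single_index (h := fun (_ : Unit) e => t ^ e) (pow_zero _)]
  rfl

/-- The line `T ↦ a·T` through the origin of `ℚ_p^σ`, as a substitution `Xₛ ↦ aₛ X`. [folklore] -/
def lineSubst (a : σ → ℚ_[p]) : σ → ℚ_[p]⟦X⟧ := fun s => PowerSeries.C (a s) * PowerSeries.X

omit [Fintype σ] [DecidableEq σ] in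
/-- The line substitution has no constant terms. [folklore] -/
theorem constantCoeff_lineSubst (a : σ → ℚ_[p]) (s : σ) :
    MvPowerSeries.constantCoeff (lineSubst a s) = 0 := by
  show PowerSeries.constantCoeff (PowerSeries.C (a s) * PowerSeries.X) = 0
  simp

omit [DecidableEq σ] in
/-- … hence is substitutable. [folklore] -/
theorem hasSubst_lineSubst (a : σ → ℚ_[p]) : MvPowerSeries.HasSubst (lineSubst a) :=
  MvPowerSeries.hasSubst_of_constantCoeff_zero (constantCoeff_lineSubst a)

omit [Fintype σ] [DecidableEq σ] in
/-- … and integral for `a ∈ ℤ_p^σ`. [folklore] -/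
theorem isPadicInt_lineSubst {a : σ → ℚ_[p]} (ha : ∀ s, ‖a s‖ ≤ 1) (s : σ) :
    IsPadicInt (lineSubst a s) :=
  (IsPadicInt.C (σ := Unit) (ha s)).mul IsPadicInt.powerSeries_X

omit [Fintype σ] [DecidableEq σ] in
/-- The monomial `∏ₛ (aₛX)^{d s} = (∏ₛ aₛ^{d s}) · X^{|d|}`. [folklore] -/
theorem prod_lineSubst_pow (a : σ → ℚ_[p]) (d : σ →₀ ℕ) :
    (d.prod fun s e => lineSubst a s ^ e) =
      PowerSeries.C (d.prod fun s e => a s ^ e) * PowerSeries.X ^ (d.sum fun _ e => e) := by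
  unfold lineSubst
  rw [Finsupp.prod, Finsupp.prod, Finsupp.sum]
  simp_rw [mul_pow, ← map_pow]
  rw [Finset.prod_mul_distrib, ← map_prod, Finset.prod_pow_eq_pow_sum]

/-- **Coefficients along a line**: the `n`-th coefficient of `F(a·T)` is the degree-`n`
homogeneous part of `F` evaluated at `a`:
`coeff n (F(a·T)) = Σ_{|d| = n} F_d ∏ₛ aₛ^{d s}`. [folklore] -/
theorem coeff_subst_line (F : MvPowerSeries σ ℚ_[p]) (a : σ → ℚ_[p]) (n : ℕ) :
    PowerSeries.coeff n (MvPowerSeries.subst (lineSubst a) F) =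
      ∑ d ∈ (Finset.univ : Finset σ).finsuppAntidiag n,
        MvPowerSeries.coeff d F * d.prod fun s e => a s ^ e := by
  classical
  rw [PowerSeries.coeff, MvPowerSeries.coeff_subst (hasSubst_lineSubst a)]
  simp_rw [prod_lineSubst_pow, smul_eq_mul]
  have hterm : ∀ d : σ →₀ ℕ, MvPowerSeries.coeff d F *
      MvPowerSeries.coeff (Finsupp.single () n) (PowerSeries.C (d.prod fun s e => a s ^ e) *
        PowerSeries.X ^ (d.sum fun _ e => e)) =
      if (d.sum fun _ e => e) = n then MvPowerSeries.coeff d F * d.prod (fun s e => a s ^ e)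
      else 0 := by
    intro d
    rw [← PowerSeries.coeff, PowerSeries.coeff_C_mul_X_pow]
    by_cases h : (d.sum fun _ e => e) = n
    · rw [if_pos h, if_pos h.symm]
    · rw [if_neg h, if_neg (Ne.symm h), mul_zero]
  simp_rw [hterm]
  rw [finsum_eq_sum_of_support_subset _ (s := (Finset.univ : Finset σ).finsuppAntidiag n)]
  · refine Finset.sum_congr rfl fun d hd => ?_
    rw [Finset.mem_finsuppAntidiag'] at hd
    rw [if_pos hd.1]
  · intro d hd
    simp only [Function.mem_support, ne_eq, ite_eq_right_iff, Classical.not_imp] at hd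
    rw [Finset.mem_coe, Finset.mem_finsuppAntidiag']
    exact ⟨hd.1, Finset.subset_univ _⟩

/-- The degree-`n` homogeneous part of `F`, as the polynomial
`MvPowerSeries.truncFinset ℚ_[p] (univ.finsuppAntidiag n) F` (Mathlib), evaluated at `a`, is the
`n`-th coefficient along the line `a·T`. [folklore] -/
theorem eval_truncFinset_antidiag (F : MvPowerSeries σ ℚ_[p]) (a : σ → ℚ_[p]) (n : ℕ) :
    MvPolynomial.eval a (MvPowerSeries.truncFinset ℚ_[p]
        ((Finset.univ : Finset σ).finsuppAntidiag n) F) =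
      PowerSeries.coeff n (MvPowerSeries.subst (lineSubst a) F) := by
  rw [coeff_subst_line, MvPowerSeries.truncFinset_apply, map_sum]
  refine Finset.sum_congr rfl fun d _ => ?_
  rw [MvPolynomial.eval_monomial]

omit [DecidableEq σ] in
/-- **Identity theorem (many variables)**: an integral `F ∈ ℚ_p⟦σ⟧` whose values vanish on the
open unit polydisc is zero. [folklore] -/
theorem eq_zero_of_padicEvalMv_eq_zero {F : MvPowerSeries σ ℚ_[p]} (hF : IsPadicInt F)
    (h : ∀ pt : σ → ℚ_[p], (∀ s, ‖pt s‖ < 1) → padicEvalMv F pt = 0) : F = 0 := by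
  classical
  -- along every line through an integral point the one-variable series vanishes
  have hline : ∀ a : σ → ℚ_[p], (∀ s, ‖a s‖ < 1) →
      MvPowerSeries.subst (lineSubst a) F = 0 := by
    intro a ha
    have ha' : ∀ s, ‖a s‖ ≤ 1 := fun s => (ha s).le
    have hint : IsPadicInt (MvPowerSeries.subst (lineSubst a) F) :=
      hF.subst (isPadicInt_lineSubst ha') (hasSubst_lineSubst a)
    refine eq_zero_of_padicEval_eq_zero hint fun t ht => ?_
    rw [padicEval_eq_padicEvalMv, padicEvalMv_subst hF (isPadicInt_lineSubst ha')
      (constantCoeff_lineSubst a) (fun _ => ht)]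
    have hval : (fun s => padicEvalMv (lineSubst a s) fun _ : Unit => t) = fun s => a s * t := by
      funext s
      have hC : IsPadicInt (PowerSeries.C (a s) : ℚ_[p]⟦X⟧) := IsPadicInt.C (σ := Unit) (ha' s)
      rw [← padicEval_eq_padicEvalMv, lineSubst, padicEval_mul hC IsPadicInt.powerSeries_X ht,
        padicEval_C, padicEval_X]
    rw [hval]
    exact h _ fun s => by
      rw [norm_mul]; exact mul_lt_one_of_nonneg_of_lt_one_right (ha' s) (norm_nonneg _) ht
  -- hence every homogeneous part vanishes on the polydisc, so is the zero polynomial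
  have hhom : ∀ n, MvPowerSeries.truncFinset ℚ_[p]
      ((Finset.univ : Finset σ).finsuppAntidiag n) F = 0 := by
    intro n
    refine MvPolynomial.funext_set (fun _ => Metric.ball (0 : ℚ_[p]) 1)
      (fun _ => infinite_of_mem_nhds (0 : ℚ_[p]) (Metric.ball_mem_nhds 0 one_pos)) fun a ha => ?_
    have ha' : ∀ s, ‖a s‖ < 1 := fun s => by
      have := ha s (Set.mem_univ s); rwa [Metric.mem_ball, dist_zero_right] at this
    rw [map_zero, eval_truncFinset_antidiag, hline a ha', map_zero]
  -- and so every coefficient of `F` vanishes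
  ext d
  have hmem : d ∈ (Finset.univ : Finset σ).finsuppAntidiag (d.sum fun _ e => e) := by
    rw [Finset.mem_finsuppAntidiag']; exact ⟨rfl, Finset.subset_univ _⟩
  rw [map_zero, ← MvPowerSeries.coeff_truncFinset_of_mem F hmem, hhom, MvPolynomial.coeff_zero]

omit [DecidableEq σ] in
/-- **Equality from equal values (many variables)**: two integral series agreeing on the open
unit polydisc are equal. [folklore] -/
theorem eq_of_padicEvalMv_eq {F G : MvPowerSeries σ ℚ_[p]} (hF : IsPadicInt F)
    (hG : IsPadicInt G)
    (h : ∀ pt : σ → ℚ_[p], (∀ s, ‖pt s‖ < 1) → padicEvalMv F pt = padicEvalMv G pt) : F = G := by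
  rw [← sub_eq_zero]
  exact eq_zero_of_padicEvalMv_eq_zero (hF.sub hG) fun pt hpt => by
    rw [padicEvalMv_sub hF hG hpt, h pt hpt, sub_self]

end Literature.NumberTheory.EllipticCurves
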